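import Summits.BirchSwinnertonDyer.BirchSwinnertonDyer.Theorems.TeichmullerTwistDescentCellsFromResidue
import Summits.BirchSwinnertonDyer.BirchSwinnertonDyer.Theorems.AdditiveKolyvaginRoadManinFrameResidueProperRTameTwistFull57
import HarnessLib

/-!
# Route `TeichmullerTwistDescent`, cruxes PSMU (stmt-BirchSwinnertonDyer-22638) / SCMU57
# (stmt-BirchSwinnertonDyer-22639): the `p ∈ {5, 7}` on-curve cells OFF the Kosters–Pannekoek sub-residue,
# granted ONE named fact (Kato's zeta elements in Néron units) — `--supports`

Cell `pub/bsd-wall` (D-0145 line route-BirchSwinnertonDyer-TeichmullerTwistDescent, DRAFT rev 0), seat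
`bsd-line-ttd-p2` (prover 2/2, g0). THEOREMS ONLY (no definition, no named fact, no `sorry`); nothing is
booked, no item is closed, BSD is not proved by this.

The Weil-type-free cell at `p ∈ {5, 7}` of `TeichmullerTwistDescentPrincipalSeriesCells.lean` — `W`
globally minimal with a lattice-optimal datum at its conductor level, additive at `p ∈ {5, 7}`, `E[p]`
irreducible, no `Iₙ*` fibre ⟹ `p ∤ c` — HOLDS at every such `W` WITHOUT a `ℚ_p`-rational point of order `p`
(`W(ℚ_p)[p] = 0`: the complement of the Kosters–Pannekoek exceptional congruence `a₄ ≡ 10 (25)` /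
`a₆ ≡ 14 (49)`), GRANTED the Literature fact
`kato_neron_isIntegral_twistedSymbolSum_of_additive_five_le` (p576988; Kato 2004 (8.1.3)/Thm 9.7/Thm 6.6
read in Néron units via Kim–Nakamura Cor. 2.4 ⟸ Kosters–Pannekoek): this is seat `bsd-wall-manin-p1`'s
`ManinFrameResidueProperRTameTwist.not_dvd_c_of_tameTwist57` (p579959) read at the conductor level
(`p² ∣ N(W)` by additivity; `a_ℓ = ±1` at `ℓ ∥ N` by Kraus–Oesterlé). The `Iₙ*` hypothesis is not even
used. Consequently (PS57) and (SC57), hence the `p ∈ {5, 7}` part of PSMU and all of SCMU57, are reduced to: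
the named fact (XL) + the optimal curves at `p ∈ {5, 7}` with `W(ℚ_p)[p] ≠ 0` (Kodaira II/III at 5,
II at 7 by the congruences; seat manin-p1's KP57 census: 49 of 1 159 residue cells in Cremona's range).
[cite: Kato2004Asterisque, (8.1.3) (p. 180), Thm. 9.7 (p. 189)] [cite: KimNakamura2020, Cor. 2.4]
[cite: KostersPannekoek2017, Thm. 1 and Cor. 2] [cite: KrausOesterle1992, §3 Lemme 1]
-/

set_option autoImplicit false
-- single-conjunct summit: `Summit.BirchSwinnertonDyer.BirchSwinnertonDyer.…` repeats the name by design
set_option linter.dupNamespace false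

noncomputable section

open scoped Classical

open WeierstrassCurve IsDedekindDomain Rat.HeightOneSpectrum
  Literature.NumberTheory.EllipticCurves Literature.NumberTheory.EllipticCurves.ModularForms
  Literature.NumberTheory.EllipticCurves.Rank1Residual Literature.NumberTheory.DiophantineGeometry
  Summit.BirchSwinnertonDyer.Rank1Residual Summit.BirchSwinnertonDyer.Rank1Residual.Additive
  Summit.BirchSwinnertonDyer.BirchSwinnertonDyer.Theses.TeichmullerTwistDescent
  Summit.BirchSwinnertonDyer.BirchSwinnertonDyer.Theorems

namespace Summit.BirchSwinnertonDyer.BirchSwinnertonDyer.Theorems.TeichmullerTwistDescent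

/-- **The `p ∈ {5, 7}` on-curve cell off the Kosters–Pannekoek sub-residue, granted Kato's fact.** For `W/ℚ`
globally minimal with a lattice-optimal datum `D` at its conductor level, additive at `p ∈ {5, 7}` with
`E[p]` irreducible and NO `ℚ_p`-rational point of order `p`: `p ∤ c(D)` — GRANTED
`kato_neron_isIntegral_twistedSymbolSum_of_additive_five_le`. (`p² ∣ N(W)`: additivity; `a_ℓ = ±1` at the
primes `ℓ ∥ N(W)`: multiplicative reduction, Kraus–Oesterlé.) [cite: Kato2004Asterisque, Thm. 9.7 (p. 189)]
[cite: KostersPannekoek2017, Thm. 1 and Cor. 2] [cite: KrausOesterle1992, §3 Lemme 1] -/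
theorem cell57_of_kato57_of_noPTorsion (hK : kato_neron_isIntegral_twistedSymbolSum_of_additive_five_le)
    (W : WeierstrassCurve ℚ) [W.IsElliptic] [W.IsGloballyMinimal] (p : ℕ) [Fact p.Prime]
    [NeZero (W.conductorNorm ℤ)] (D : ModularParametrizationData W (W.conductorNorm ℤ))
    (hp57 : p = 5 ∨ p = 7) (hadd : Addv W p) (hirr : Irr W p)
    (hPT : ∀ P : (W.baseChange ℚ_[p]).toAffine.Point, p • P = 0 → P = 0)
    (hlat : ∀ z ∈ D.L.lattice, ∃ w ∈ periodLattice D.f, z = D.c * w) : ¬ (p : ℤ) ∣ D.c := by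
  have hpN : p ^ 2 ∣ W.conductorNorm ℤ := sq_dvd_conductorNorm_of_not_good_of_not_mult hadd
  have ha : ∀ ℓ ∈ (W.conductorNorm ℤ).primeFactors, ¬ ℓ ^ 2 ∣ W.conductorNorm ℤ →
      W.LFunction ℓ = 1 ∨ W.LFunction ℓ = -1 := by
    intro ℓ hℓ hℓ2
    haveI : Fact ℓ.Prime := ⟨Nat.prime_of_mem_primeFactors hℓ⟩
    rcases hasGoodReductionAtPrime_or_hasMultiplicativeReductionAtPrime_of_not_sq_dvd_conductorNorm
        (V := W) hℓ2 with hg | hmul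
    · exact absurd (Nat.dvd_of_mem_primeFactors hℓ) (not_dvd_conductorNorm_of_hasGoodReductionAtPrime W hg)
    · exact KrausOesterle1992.lFunction_apply_prime_eq_one_or_eq_neg_one_of_mult W ℓ hmul
  exact ManinFrameResidueProperRTameTwist.not_dvd_c_of_tameTwist57 hK hp57 W D hlat hPT hadd hirr hpN ha

/-- **Hence (PS57) and (SC57) are reduced, granted Kato's fact, to the optimal curves WITH a `ℚ_p`-rational
point of order `p`** (the Kosters–Pannekoek exceptional sub-residue): the Weil-type-free cell holds as soon
as it holds on that sub-residue. [cite: KostersPannekoek2017, Cor. 2] -/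
theorem cell57_of_kato57_of_exceptionalCell
    (hK : kato_neron_isIntegral_twistedSymbolSum_of_additive_five_le)
    (hexc : ∀ (W : WeierstrassCurve ℚ) [W.IsElliptic] [W.IsGloballyMinimal] (p : ℕ) [Fact p.Prime]
      [NeZero (W.conductorNorm ℤ)] (D : ModularParametrizationData W (W.conductorNorm ℤ)),
      (p = 5 ∨ p = 7) → Addv W p → Irr W p →
      (∃ P : (W.baseChange ℚ_[p]).toAffine.Point, p • P = 0 ∧ P ≠ 0) →
      (∀ n : ℕ, W.kodairaSymbolAt (placeOf p) ≠ .Istar n) →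
      (∀ z ∈ D.L.lattice, ∃ w ∈ periodLattice D.f, z = D.c * w) → ¬ (p : ℤ) ∣ D.c) :
    ∀ (W : WeierstrassCurve ℚ) [W.IsElliptic] [W.IsGloballyMinimal] (p : ℕ) [Fact p.Prime]
      [NeZero (W.conductorNorm ℤ)] (D : ModularParametrizationData W (W.conductorNorm ℤ)),
      (p = 5 ∨ p = 7) → Addv W p → Irr W p →
      (∀ n : ℕ, W.kodairaSymbolAt (placeOf p) ≠ .Istar n) →
      (∀ z ∈ D.L.lattice, ∃ w ∈ periodLattice D.f, z = D.c * w) → ¬ (p : ℤ) ∣ D.c := by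
  intro W _ _ p _ _ D hp57 hadd hirr hI hlat
  by_cases hPT : ∀ P : (W.baseChange ℚ_[p]).toAffine.Point, p • P = 0 → P = 0
  · exact cell57_of_kato57_of_noPTorsion hK W p D hp57 hadd hirr hPT hlat
  · push Not at hPT
    exact hexc W p D hp57 hadd hirr hPT hI hlat

/-- **SCMU57 granted Kato's fact and Modularity, from the exceptional sub-cell alone** (composition with
`supercuspidalOptimalManinUnitFiveSeven_of_cell`, p580436). [cite: KostersPannekoek2017, Cor. 2] -/
theorem supercuspidalOptimalManinUnitFiveSeven_of_kato57_of_exceptionalCell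
    (hK : kato_neron_isIntegral_twistedSymbolSum_of_additive_five_le) (hnf : exists_isNewformOf)
    (hexc : ∀ (W : WeierstrassCurve ℚ) [W.IsElliptic] [W.IsGloballyMinimal] (p : ℕ) [Fact p.Prime]
      [NeZero (W.conductorNorm ℤ)] (D : ModularParametrizationData W (W.conductorNorm ℤ)),
      (p = 5 ∨ p = 7) → Addv W p → Irr W p →
      (∃ P : (W.baseChange ℚ_[p]).toAffine.Point, p • P = 0 ∧ P ≠ 0) →
      (∀ n : ℕ, W.kodairaSymbolAt (placeOf p) ≠ .Istar n) →
      (∀ z ∈ D.L.lattice, ∃ w ∈ periodLattice D.f, z = D.c * w) → ¬ (p : ℤ) ∣ D.c) :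
    SupercuspidalOptimalManinUnitFiveSeven :=
  supercuspidalOptimalManinUnitFiveSeven_of_cell hnf
    (fun W _ _ p _ _ D hp57 hadd hirr _ hI hlat =>
      cell57_of_kato57_of_exceptionalCell hK hexc W p D hp57 hadd hirr hI hlat)

end Summit.BirchSwinnertonDyer.BirchSwinnertonDyer.Theorems.TeichmullerTwistDescent

end
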